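import Summits.Ventures.LatticeQCDFlow.Scoring.WilsonFlowReflectionCovariance
import Literature.MathematicalPhysics.QuantumFieldTheory.LatticeGaugeProofs
import HarnessLib

/-!
# `⟨q(x)⟩ = 0` and `⟨q_t(x)⟩ = 0` at EVERY site: the clover charge density, bare and flowed, has zero Wilson mean pointwise

HONEST FRAMING: exact (Metropolis-corrected) sampling algorithms for lattice gauge theory;
figures of merit are autocorrelation/cost numbers at stated couplings and volumes; no
continuum-physics claim.

Venture `LatticeQCDFlow` (cell pub-lqcd), sub-topic `Scoring`; FANOUT row 16 (`su2-base`).  NEW WORK of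
the cell (placement rule); third file of the `⟨Q⟩ = 0` packet after `Scoring/CloverChargeMeanZero`
(total bare charge; the density only at sites of the reflection hyperplanes) and
`Scoring/WilsonFlowReflectionCovariance` (flow ∘ reflection = reflection ∘ flow; total flowed charge).
The missing ingredient for the POINTWISE statement is lattice translation invariance of the torus
Wilson measure, which the Literature has (`LatticeGaugeProofs`: `wilsonExpectation_comp_torusConfigShift`,
translations `TorusTranslation.torusConfigShift v : U ↦ (e ↦ U(e − v))` of `TorusConfigShift.lean`),
together with the translation covariance of the `SU(n)` Wilson flow (`WilsonFlow.wilsonFlow_siteTranslate`).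
Nothing is cited as a fact.  Printed counterpart, NAMED ONLY: translation invariance of the periodic
Wilson theory and "`q(x)` is a pseudoscalar" (Osterwalder–Seiler 1978 §2; Lüscher 2010 §3).

## What is proved (`L ≥ 1`, every real `β`)

* §1 `cloverLeafSum_translate`, **`cloverPseudoscalar_torusConfigShift`**: the clover leaf sum and the
  clover pseudoscalar density are translation-covariant, `P_x(τ_v U) = P_{x−v}(U)` (any group `G`,
  any matrix representation `ρ`); `negReflect_zero_site`: the origin lies on a reflection hyperplane.
* §2 **`wilsonExpectation_cloverPseudoscalar_eq_zero`**: `⟨P_x⟩_{Λ,β} = 0` for EVERY site `x` of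
  `(ℤ/L)^4`, every compact `G` with a continuous unitary `ρ` (translate `x` to the origin, where
  `CloverChargeMeanZero.wilsonExpectation_cloverPseudoscalar_eq_zero_of_fixed` applies).
* §3 (`SU(n)`, fundamental representation) `torusConfigShift_eq_siteTranslate`,
  **`wilsonFlow_torusConfigShift`** (`V_t(τ_v U) = τ_v(V_t U)`, from `wilsonFlow_siteTranslate`),
  `cloverPseudoscalar_wilsonFlow_negReflect_zero_site` (the flowed density at the origin is `Θ'`-odd) and
  **`wilsonExpectation_flowedCloverPseudoscalar_eq_zero`**: `⟨P_x(V_t)⟩_{Λ,β} = 0` for EVERY site `x`,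
  every flow time `t ∈ ℝ`, every `β`, `L ≥ 1`, `n` — the pointwise form of row 16's `⟨Q⟩ = 0` check for
  the flowed clover density (`n = 2`; `n = 3` for the `SU(3)` rows).

NOT CLAIMED: anything about correlators `⟨P_x P_y⟩` (reflection positivity gives their sign off the
hyperplanes — Literature `CloverPseudoscalarParity` serves that elsewhere), `⟨Q²⟩`, `τ_int`, or numbers.
-/

noncomputable section

open Matrix MeasureTheory
open Literature.MathematicalPhysics.QuantumFieldTheory
open Literature.MathematicalPhysics.QuantumLattice (fundamentalRep continuous_fundamentalRep
  fundamentalRep_mem_unitaryGroup cloverPseudoscalar cloverLeafSum flowedClover flowedClover_zero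
  MatrixLinkField)

namespace Summit.Ventures.LatticeQCDFlow.Scoring

/-! ## §1 Translation covariance of the clover density -/

section Translate

variable {d L N : ℕ} {G : Type*} [Group G] (ρ : G →* Matrix (Fin N) (Fin N) ℂ)

/-- **The clover leaf sum is translation-covariant**: reading the translated link field `e ↦ V(e − v)`
around `x` is reading `V` around `x − v`. -/
theorem cloverLeafSum_translate (V : MatrixLinkField d (ZMod L) N) (v x : Site d L) (μ ν : Fin d) :
    cloverLeafSum (fun e => V (e.1 - v, e.2)) x μ ν = cloverLeafSum V (x - v) μ ν := by
  have h1 : ∀ a : Site d L, x + a - v = x - v + a := fun a => by abel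
  have h2 : ∀ a : Site d L, x - a - v = x - v - a := fun a => by abel
  have h3 : ∀ a b : Site d L, x - a + b - v = x - v - a + b := fun a b => by abel
  have h4 : ∀ a b : Site d L, x - a - b - v = x - v - a - b := fun a b => by abel
  simp only [cloverLeafSum, h1, h2, h3, h4]

/-- **The clover pseudoscalar density is translation-covariant**: `P_x(τ_v U) = P_{x−v}(U)` for the torus
translation `τ_v U = (e ↦ U(e − v))` (`TorusTranslation.torusConfigShift`). -/
theorem cloverPseudoscalar_torusConfigShift [MeasurableSpace G] (v x : Site 4 L)
    (U : GaugeConfig 4 L G) :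
    cloverPseudoscalar ρ x (TorusTranslation.torusConfigShift v U) = cloverPseudoscalar ρ (x - v) U := by
  have key : ∀ μ ν : Fin 4,
      flowedClover ρ 0 (TorusTranslation.torusConfigShift v U : GaugeConfig 4 L G) x μ ν =
        flowedClover ρ 0 U (x - v) μ ν := by
    intro μ ν
    rw [flowedClover_zero, flowedClover_zero]
    simp only [TorusTranslation.torusConfigShift_apply]
    exact congrArg _ (congrArg _ (cloverLeafSum_translate (fun e => ρ (U e)) v x μ ν))
  simp only [cloverPseudoscalar, key]

/-- The origin lies on the reflection hyperplane `t = 0`: `θ'0 = 0`. -/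
theorem negReflect_zero_site [NeZero d] : (0 : Site d L).negReflect = 0 :=
  WilsonSiteRP.negReflect_of_two_mul (by simp)

end Translate

/-! ## §2 `⟨P_x⟩ = 0` at every site -/

section Bare

variable {L N : ℕ} [NeZero L]
variable {G : Type*} [Group G] [TopologicalSpace G] [IsTopologicalGroup G] [CompactSpace G]
  [MeasurableSpace G] [BorelSpace G]
variable (ρ : G →* Matrix (Fin N) (Fin N) ℂ)

/-- **`⟨P_x⟩_{Λ,β} = 0` at EVERY site** of the torus `(ℤ/L)^4` (`L ≥ 1`), for every compact gauge group
with a continuous unitary matrix representation `ρ` and every real `β`: translate `x` to the origin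
(`wilsonExpectation_comp_torusConfigShift`, translation invariance of `μ_{Λ,β}`), where the density is
odd under the site reflection (`wilsonExpectation_cloverPseudoscalar_eq_zero_of_fixed`). -/
theorem wilsonExpectation_cloverPseudoscalar_eq_zero (hρ : Continuous ρ)
    (hρu : ∀ g, ρ g ∈ Matrix.unitaryGroup (Fin N) ℂ) (β : ℝ) (x : Site 4 L) :
    wilsonExpectation ρ β (fun U : GaugeConfig 4 L G => cloverPseudoscalar ρ x U) = 0 := by
  have h0 : wilsonExpectation ρ β (fun U : GaugeConfig 4 L G => cloverPseudoscalar ρ 0 U) = 0 :=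
    wilsonExpectation_cloverPseudoscalar_eq_zero_of_fixed ρ hρ hρu β negReflect_zero_site
  have hshift := wilsonExpectation_comp_torusConfigShift ρ β (-x)
    (fun U : GaugeConfig 4 L G => cloverPseudoscalar ρ 0 U)
  have hfun : ((fun U : GaugeConfig 4 L G => cloverPseudoscalar ρ 0 U) ∘
      TorusTranslation.torusConfigShift (-x)) = fun U => cloverPseudoscalar ρ x U := by
    funext U
    rw [Function.comp_apply, cloverPseudoscalar_torusConfigShift, zero_sub, neg_neg]
  rw [hfun, h0] at hshift
  exact hshift

end Bare

/-! ## §3 The flowed density: `⟨P_x(V_t)⟩ = 0` at every site and flow time (`SU(n)`) -/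

section Flowed

variable {d L n : ℕ}

/-- The torus translation of `TorusConfigShift.lean` is the site translation of `WilsonFlow.lean` by the
opposite vector: `τ_v U = U.siteTranslate (−v)`. -/
theorem torusConfigShift_eq_siteTranslate {G : Type*} [MeasurableSpace G] (v : Site d L)
    (U : GaugeConfig d L G) : TorusTranslation.torusConfigShift v U = U.siteTranslate (-v) := by
  funext e
  rw [TorusTranslation.torusConfigShift_apply, GaugeConfig.siteTranslate_apply, sub_eq_add_neg]

variable [NeZero L]

/-- **The Wilson flow commutes with torus translations**: `V_t(τ_v U) = τ_v (V_t U)`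
(`WilsonFlow.wilsonFlow_siteTranslate` in the `torusConfigShift` spelling). -/
theorem wilsonFlow_torusConfigShift (t : ℝ) (v : Site d L)
    (U : GaugeConfig d L (Matrix.specialUnitaryGroup (Fin n) ℂ)) :
    wilsonFlow t (TorusTranslation.torusConfigShift v U) =
      TorusTranslation.torusConfigShift v (wilsonFlow t U) := by
  rw [torusConfigShift_eq_siteTranslate, torusConfigShift_eq_siteTranslate, wilsonFlow_siteTranslate]

/-- The flowed clover density at the origin is odd under the site reflection:
`P_0(V_t(Θ'U)) = −P_0(V_t U)` (flow ∘ reflection = reflection ∘ flow, and `θ'0 = 0`). -/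
theorem cloverPseudoscalar_wilsonFlow_negReflect_zero_site (t : ℝ)
    (U : GaugeConfig 4 L (Matrix.specialUnitaryGroup (Fin n) ℂ)) :
    cloverPseudoscalar (fundamentalRep (Fin n)) 0 (wilsonFlow t U.negReflect) =
      -cloverPseudoscalar (fundamentalRep (Fin n)) 0 (wilsonFlow t U) := by
  rw [wilsonFlow_negReflect, cloverPseudoscalar_negReflect (fundamentalRep (Fin n))
    fundamentalRep_mem_unitaryGroup, negReflect_zero_site]

/-- **`⟨P_x(V_t)⟩_{Λ,β} = 0` at EVERY site and EVERY flow time.**  For the Wilson theory of `SU(n)` in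
the fundamental representation on `(ℤ/L)^4` (`L ≥ 1`), every real `β`, every site `x` and every real
flow time `t`: the Wilson-measure mean of the clover pseudoscalar density of the flowed configuration
`V_t = wilsonFlow t U` at `x` vanishes (translate to the origin with `wilsonFlow_torusConfigShift` and
translation invariance of `μ_{Λ,β}`; at the origin the observable is `Θ'`-odd). -/
theorem wilsonExpectation_flowedCloverPseudoscalar_eq_zero (n : ℕ) (β t : ℝ) (x : Site 4 L) :
    wilsonExpectation (fundamentalRep (Fin n)) β
      (fun U : GaugeConfig 4 L (Matrix.specialUnitaryGroup (Fin n) ℂ) =>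
        cloverPseudoscalar (fundamentalRep (Fin n)) x (wilsonFlow t U)) = 0 := by
  have h0 : wilsonExpectation (fundamentalRep (Fin n)) β
      (fun U : GaugeConfig 4 L (Matrix.specialUnitaryGroup (Fin n) ℂ) =>
        cloverPseudoscalar (fundamentalRep (Fin n)) 0 (wilsonFlow t U)) = 0 :=
    wilsonExpectation_eq_zero_of_negReflect_odd (fundamentalRep (Fin n)) (continuous_fundamentalRep (Fin n)) β
      fun U => cloverPseudoscalar_wilsonFlow_negReflect_zero_site t U
  have hshift := wilsonExpectation_comp_torusConfigShift (fundamentalRep (Fin n)) β (-x)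
    (fun U : GaugeConfig 4 L (Matrix.specialUnitaryGroup (Fin n) ℂ) =>
      cloverPseudoscalar (fundamentalRep (Fin n)) 0 (wilsonFlow t U))
  have hfun : ((fun U : GaugeConfig 4 L (Matrix.specialUnitaryGroup (Fin n) ℂ) =>
      cloverPseudoscalar (fundamentalRep (Fin n)) 0 (wilsonFlow t U)) ∘
        TorusTranslation.torusConfigShift (-x)) =
      fun U => cloverPseudoscalar (fundamentalRep (Fin n)) x (wilsonFlow t U) := by
    funext U
    rw [Function.comp_apply, wilsonFlow_torusConfigShift, cloverPseudoscalar_torusConfigShift, zero_sub,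
      neg_neg]
  rw [hfun, h0] at hshift
  exact hshift

end Flowed

end Summit.Ventures.LatticeQCDFlow.Scoring

end
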